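import Summits.HodgeConjecture.HodgeConjecture.Theorems.F0P3cStCharTSWeylHypJacobianWeight   -- ★ p852079 (this seat) (J6) FILE 5 `tubeJacobianLocal_vanDijkWeight_sq`
import Summits.HodgeConjecture.HodgeConjecture.Theorems.F0P3cStCharTSWeylHypSocketAdapter    -- ★ p851891 (F0P3-p02 g21) «ADAPTER-M★» (the socket shape this file serves); brings ★ `compactCore`, ★ `exists_conjFamily`
import HarnessLib

/-!
# F0 · P3c · line LH6 «StCharTS» — ROAD «JAC-LOC» brick (J6) FILE 6 «SOCKET»: the unconditional local tube Jacobian `(Re Δ)² = D_G²` of ★ p852079, READ IN THE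
# `hJacLoc` SOCKET SHAPE OF ★ «ADAPTER-M» p851891 (all Haar `tT` of `compactCore`-mass `1`, Borel `G ⧸ M`, explicit tube set) (Harish-Chandra 1970 L. 22; Rogawski 1990 §12.5)

Cell `pub/hodgecm-mathlib`, crux H413 = `stmt-HodgeConjecture-24833` (lane `--supports`, helper); seat LH6-p04 (g6).  THEOREMS ONLY; sorry-free; ★-only imports; no definition ∕
instance ∕ notation ∕ hypothesis beyond the weight identity `hDM`; axioms TRIO.  HONEST LABEL: count-neutral, pure plumbing, closes no organ by itself; HC_CM is proved only modulo
the 7 printed citations (2 remaining: hLiu418 = `stmt-HodgeConjecture-24832`, h413 = `stmt-HodgeConjecture-24833`) until rung 0 closes.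

WHAT.  `G = U(Φ₃)(L⁺_v)` (`v` non-split), `M = (cmBorelTriple L 3 v).M`, `w` the Weyl representative, `DM : M → ℝ≥0` with `(DM t : ℝ) = (Re Δ(t))²`.
**`tubeJacobianSocket_vanDijkWeight_sq`**: the hypothesis `hJacLoc` of ★ «ADAPTER-M» `tubeJacobianLocal_cartan_of_cmTorus` ∕ `tubeJacobianLocal_cartan_Gqs_of_cmTorus` VERBATIM
(its `letI := borel _; haveI := ⟨rfl⟩` on `G ⧸ M` — written with `;` separators, the line-break form does not parse in a theorem TYPE here — `∀ tT` Haar inversion-symmetric with `tT (compactCore M) = 1`, the `w`-clause, the tube as the set `{x t x⁻¹ | xM ∈ A₀, t ∈ V}`), for this `DM`.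
PROOF: ★ p852079 `tubeJacobianLocal_vanDijkWeight_sq` at `tm := tT` (a Haar measure is left-invariant, finite on compacts, positive on opens) and the conjugation family `Φ` of
★ `F0P3cStCharTSWeylHypMeasure.exists_conjFamily` (`M` is abelian: ★ `mul_comm_of_mem_torusU_cmLocal`); the set is `Φ '' (A₀ ×ˢ V)` by `hΦ` (the two-line set identity of ★ p851891).
USE (road holder ∕ (E4) hand): `tubeJacobianLocal_cartan_Gqs_of_cmTorus L v ν hTM hTcl Φ hΦ tm htm w hw DM D hDD (tubeJacobianSocket_vanDijkWeight_sq L v hns ν w hw DM hDM)` — the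
instance binders of this file are generic, so the organ's (`Gqs L v`) instances are passed by position as ★ p851891 §2 does.

## References
* [HarishChandra1970] Harish-Chandra, *Harmonic analysis on reductive p-adic groups*, LNM 162 (1970), Lemma 20, Lemma 22.
* [Rogawski1990] J. D. Rogawski, *Automorphic Representations of Unitary Groups in Three Variables*, Ann. of Math. Stud. 123 (1990), §12.5 p. 182; §3.6 p. 29.
* [vanDijk1972] G. van Dijk, *Computation of certain induced characters of p-adic groups*, Math. Ann. 199 (1972), §2.
-/

set_option autoImplicit false
set_option linter.dupNamespace false

noncomputable section

open MeasureTheory Measure Set Filter Topology Function NumberField IsDedekindDomain Matrix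
open Literature.MeasureTheory.Group
open Literature.NumberTheory Literature.NumberTheory.Automorphic Literature.NumberTheory.Automorphic.UnitaryGroup Literature.NumberTheory.Rogawski1990
open Summit.HodgeConjecture.HodgeConjecture.Cruxes.H413
open Summit.HodgeConjecture.HodgeConjecture.Cruxes.H413.F0P3cStCharTSWeylHypMeasure
open Summit.HodgeConjecture.HodgeConjecture.Cruxes.H413.F0P3cStCharTSWeylHypCM
open Summit.HodgeConjecture.HodgeConjecture.Cruxes.H413.F0P3cStCharTSWeylHypTorsor
open Summit.HodgeConjecture.HodgeConjecture.Cruxes.H413.F0P3cStCharTSWeylHypJacobianWeight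
open scoped ENNReal NNReal MatrixGroups Pointwise

namespace Summit.HodgeConjecture.HodgeConjecture.Cruxes.H413.F0P3cStCharTSWeylHypJacobianSocket

section CM

variable (L : Type) [Field L] [NumberField L] [IsCMField L] (v : HeightOneSpectrum (𝓞 ↥(maximalRealSubfield L)))

set_option maxHeartbeats 1600000 in
set_option synthInstance.maxHeartbeats 400000 in
-- long socket statement (class of ★ p851891 ∕ ★ p851645)
/-- **(J6) «SOCKET» — the unconditional local tube Jacobian `(Re Δ)² = D_G²` in ★ «ADAPTER-M»'s `hJacLoc` shape.**  For `DM : M → ℝ≥0` with `(DM t : ℝ) = (Re Δ(t))²`: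
for every Haar measure `tT` of `M` with inversion symmetry and `tT (compactCore M) = 1`, every regular `t₀ ∈ M` has an open `U ∋ t₀` and a Borel `A₀ ⊆ G ⧸ M` with
`0 < (ν∕tT)(A₀) < ∞` such that `ν {x t x⁻¹ | xM ∈ A₀, t ∈ V} = (ν∕tT)(A₀) · ∫⁻_V DM dtT` for every measurable regular `w`-free `V ⊆ U` — module docstring.
[cite: HarishChandra1970, Lemma 20; Lemma 22] [cite: Rogawski1990, §12.5 p. 182; §3.6 p. 29] [cite: vanDijk1972, §2] -/
theorem tubeJacobianSocket_vanDijkWeight_sq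
    (hns : ∀ w : PlacesOver L v, IsCMField.complexConj L • w.1 = w.1)
    [MeasurableSpace ↥(unitaryGroupOfForm (conjLocal L (IsCMField.complexConj L) v) (cmLocalForm L 3 v))] [BorelSpace ↥(unitaryGroupOfForm (conjLocal L (IsCMField.complexConj L) v) (cmLocalForm L 3 v))] [LocallyCompactSpace ↥(unitaryGroupOfForm (conjLocal L (IsCMField.complexConj L) v) (cmLocalForm L 3 v))] [SecondCountableTopology ↥(unitaryGroupOfForm (conjLocal L (IsCMField.complexConj L) v) (cmLocalForm L 3 v))] [T2Space ↥(unitaryGroupOfForm (conjLocal L (IsCMField.complexConj L) v) (cmLocalForm L 3 v))]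
    (ν : Measure ↥(unitaryGroupOfForm (conjLocal L (IsCMField.complexConj L) v) (cmLocalForm L 3 v))) [ν.IsHaarMeasure] [ν.IsMulRightInvariant]
    (w : ↥(unitaryGroupOfForm (conjLocal L (IsCMField.complexConj L) v) (cmLocalForm L 3 v))) (hw : Units.val (w : GL (Fin 3) (LocalRing L v)) = cmLocalForm L 3 v)
    (DM : ↥(cmBorelTriple L 3 v).M → ℝ≥0) (hDM : ∀ t : ↥(cmBorelTriple L 3 v).M, (DM t : ℝ) = ((F0P3cStCharTSTorusDefs.vanDijkWeight L v t).re) ^ 2) :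
    (letI : MeasurableSpace (↥(unitaryGroupOfForm (conjLocal L (IsCMField.complexConj L) v) (cmLocalForm L 3 v)) ⧸ (cmBorelTriple L 3 v).M) := borel _; haveI : BorelSpace (↥(unitaryGroupOfForm (conjLocal L (IsCMField.complexConj L) v) (cmLocalForm L 3 v)) ⧸ (cmBorelTriple L 3 v).M) := ⟨rfl⟩;
      ∀ (tT : Measure ↥(cmBorelTriple L 3 v).M) (_ : tT.IsHaarMeasure) (_ : tT.IsInvInvariant), tT (compactCore ↥(cmBorelTriple L 3 v).M) = 1 →
        ∀ t₀ : ↥(cmBorelTriple L 3 v).M, IsRegularElt (((t₀ : ↥(unitaryGroupOfForm (conjLocal L (IsCMField.complexConj L) v) (cmLocalForm L 3 v)))) : GL (Fin 3) (LocalRing L v)) →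
        ∃ U : Set ↥(cmBorelTriple L 3 v).M, IsOpen U ∧ t₀ ∈ U ∧
        ∃ A₀ : Set (↥(unitaryGroupOfForm (conjLocal L (IsCMField.complexConj L) v) (cmLocalForm L 3 v)) ⧸ (cmBorelTriple L 3 v).M), MeasurableSet A₀ ∧
          quotientMeasure (cmBorelTriple L 3 v).M tT (isClosed_cmBorelTriple_M L v) ν A₀ ≠ 0 ∧ quotientMeasure (cmBorelTriple L 3 v).M tT (isClosed_cmBorelTriple_M L v) ν A₀ ≠ ∞ ∧
          ∀ V : Set ↥(cmBorelTriple L 3 v).M, MeasurableSet V → V ⊆ U → (∀ t ∈ V, IsRegularElt (((t : ↥(unitaryGroupOfForm (conjLocal L (IsCMField.complexConj L) v) (cmLocalForm L 3 v)))) : GL (Fin 3) (LocalRing L v))) →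
            (∀ t ∈ V, ∀ t' ∈ V, ((t' : ↥(cmBorelTriple L 3 v).M) : ↥(unitaryGroupOfForm (conjLocal L (IsCMField.complexConj L) v) (cmLocalForm L 3 v))) ≠ w * t * w⁻¹) →
              ν {y : ↥(unitaryGroupOfForm (conjLocal L (IsCMField.complexConj L) v) (cmLocalForm L 3 v)) | ∃ (x : ↥(unitaryGroupOfForm (conjLocal L (IsCMField.complexConj L) v) (cmLocalForm L 3 v))) (t : ↥(cmBorelTriple L 3 v).M), (QuotientGroup.mk x : ↥(unitaryGroupOfForm (conjLocal L (IsCMField.complexConj L) v) (cmLocalForm L 3 v)) ⧸ (cmBorelTriple L 3 v).M) ∈ A₀ ∧ t ∈ V ∧ y = x * t * x⁻¹} =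
                quotientMeasure (cmBorelTriple L 3 v).M tT (isClosed_cmBorelTriple_M L v) ν A₀ * ∫⁻ t in V, (DM t : ℝ≥0∞) ∂tT) := by
  intro tT _ _ _ t₀ ht₀
  letI : MeasurableSpace (↥(unitaryGroupOfForm (conjLocal L (IsCMField.complexConj L) v) (cmLocalForm L 3 v)) ⧸ (cmBorelTriple L 3 v).M) := borel _
  haveI : BorelSpace (↥(unitaryGroupOfForm (conjLocal L (IsCMField.complexConj L) v) (cmLocalForm L 3 v)) ⧸ (cmBorelTriple L 3 v).M) := ⟨rfl⟩
  -- the conjugation family of the abelian torus `M`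
  have hTc : ∀ a ∈ (cmBorelTriple L 3 v).M, ∀ b ∈ (cmBorelTriple L 3 v).M, a * b = b * a :=
    fun a ha b hb => mul_comm_of_mem_torusU_cmLocal L v ha hb
  obtain ⟨Φ, hΦ⟩ := F0P3cStCharTSWeylHypMeasure.exists_conjFamily (cmBorelTriple L 3 v).M hTc
  obtain ⟨U, hUo, ht₀U, A₀, hA₀m, hA₀0, hA₀top, hJ⟩ := tubeJacobianLocal_vanDijkWeight_sq L v hns ν tT Φ hΦ w hw DM hDM t₀ ht₀
  refine ⟨U, hUo, ht₀U, A₀, hA₀m, hA₀0, hA₀top, fun V hVm hVU hVreg hVw => ?_⟩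
  have htube : {y : ↥(unitaryGroupOfForm (conjLocal L (IsCMField.complexConj L) v) (cmLocalForm L 3 v)) | ∃ (x : ↥(unitaryGroupOfForm (conjLocal L (IsCMField.complexConj L) v) (cmLocalForm L 3 v))) (t : ↥(cmBorelTriple L 3 v).M), (QuotientGroup.mk x : ↥(unitaryGroupOfForm (conjLocal L (IsCMField.complexConj L) v) (cmLocalForm L 3 v)) ⧸ (cmBorelTriple L 3 v).M) ∈ A₀ ∧ t ∈ V ∧ y = x * t * x⁻¹} = Φ '' (A₀ ×ˢ V) := by
    ext y
    constructor
    · rintro ⟨x, t, hx, ht, rfl⟩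
      exact ⟨(QuotientGroup.mk x, t), ⟨hx, ht⟩, hΦ x t⟩
    · rintro ⟨⟨q, t⟩, ⟨hq, ht⟩, rfl⟩
      obtain ⟨x, rfl⟩ := QuotientGroup.mk_surjective q
      exact ⟨x, t, hq, ht, hΦ x t⟩
  rw [htube]
  exact hJ V hVm hVU hVreg hVw

end CM

end Summit.HodgeConjecture.HodgeConjecture.Cruxes.H413.F0P3cStCharTSWeylHypJacobianSocket

end
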